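import Summits.HodgeConjecture.HodgeConjecture.Theorems.TropicalWeilObstructionTropicalHodgeBoundSimplexWords

/-!
# Crux `TropicalHodgeBound` (stmt-HodgeConjecture-18480), stub 4 — part R1b: the prism identity and the
# alternation of the swept form for an alternating `4`-form

Route `TropicalWeilObstruction` of `HodgeConjecture`, registered line `birth`
(`Cruxes/TropicalHodgeBound/Lines/birth.lean`), stub `stub_rationalHodgeCoordinates`. The rationality of
the cycle class of an effective tropical `4`-cycle of `ℝ⁸/Q·ℤ⁸` in period coordinates
(`[Z] ∈ ⋀⁴(Qℤ⁸) ⊗ ⋀⁴ℤ⁸`, Mikhalkin–Zharkov Prop. 4.3, "the homology of the torus") is proved in the sibling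
file `…DiscreteStokes` WITHOUT topology, from the two identities of this file, valid for an arbitrary
alternating `4`-form `Φ` on a real vector space:

* `simplexForm Φ u = Φ(u₁ - u₀, …, u₄ - u₀)` — `4!` times the `Φ`-content of the `4`-simplex `(u₀,…,u₄)`;
* `sweptForm Φ y z = Σ_{A ⊆ {1,2,3}} (|A|+1)⁻¹ Φ(z₀+…+z₃ ; W_A)`, `W_A = (z_j - z_0 on A, y_j - y_0 off A)` —
  `4!` times the `Φ`-content of the prism swept by the `3`-simplex `(y₀,…,y₃)` moving with velocities
  `(z₀,…,z₃)` (the integral `∫_{[0,1]×Δ³}` in closed form);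
* `simplexForm_add_sub` — PRISM IDENTITY: `h̃_Φ(u + z) - h̃_Φ(u) = Σ_{i<5} (-1)^i sweptForm Φ (u∘î) (z∘î)`
  (top minus bottom = content swept by the five facets; the chain-homotopy formula `∂P + P∂ = top - bot`
  on a constant form);
* `sweptForm_comp_perm` — the swept form is ALTERNATING under simultaneous reordering of `(y, z)`, and
  `sweptForm_add_const` — invariant under translating `y`.

Both identities are polynomial identities; they are checked by the kernel on integer coefficient tables
(file `…SimplexWords`: `apply_specArgs`, `sum_eq_of_altSum_eq_on_sorted`, `altSum_wordCoef`). The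
definitions are proof devices. No named fact, no sorry.

References: [MikhalkinZharkov2014Eigenwave] G. Mikhalkin, I. Zharkov, Tropical eigenwave and intermediate
Jacobians, LN UMI 15 (2014), Prop. 4.3; [Zharkov2020TropicalWeil] I. Zharkov, arXiv:2002.02347, p. 2.
-/

set_option linter.dupNamespace false

namespace Summit.HodgeConjecture.HodgeConjecture.Theorems.TropicalHodgeBound

open scoped BigOperators

section Forms

variable {V : Type*} [AddCommGroup V] [Module ℝ V]

/-- `h̃_Φ(u) = Φ(u₁ - u₀, u₂ - u₀, u₃ - u₀, u₄ - u₀)`: `4!` times the `Φ`-content of the oriented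
`4`-simplex `(u₀, …, u₄)`. [cite: MikhalkinZharkov2014Eigenwave, Prop. 4.3] -/
noncomputable def simplexForm (Φ : V [⋀^Fin 4]→ₗ[ℝ] ℝ) (u : Fin 5 → V) : ℝ :=
  Φ (fun j : Fin 4 => u j.succ - u 0)

/-- The SWEPT FORM of the moving `3`-simplex `(y₀,…,y₃)` with velocities `(z₀,…,z₃)`:
`Σ_{A ⊆ {1,2,3}} (|A|+1)⁻¹ · Φ(z₀+z₁+z₂+z₃ ; W_A)`, `W_A,j = z_j - z_0` (`j ∈ A`) resp. `y_j - y_0` —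
`4!` times the integral of `Φ` over the prism `[0,1] × Δ³`, `(s,λ) ↦ Σ λ_j (y_j + s z_j)`. [folklore] -/
noncomputable def sweptForm (Φ : V [⋀^Fin 4]→ₗ[ℝ] ℝ) (y z : Fin 4 → V) : ℝ :=
  ∑ A : Finset (Fin 3), (1 / ((A.card : ℝ) + 1)) *
    Φ (Fin.cons (∑ k : Fin 4, z k) (fun j : Fin 3 => if j ∈ A then z j.succ - z 0 else y j.succ - y 0))

/-- The swept form only sees differences of the `y`'s: it is invariant under translating them.
[folklore] -/
theorem sweptForm_add_const (Φ : V [⋀^Fin 4]→ₗ[ℝ] ℝ) (y z : Fin 4 → V) (t : V) :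
    sweptForm Φ (fun j => y j + t) z = sweptForm Φ y z := by
  simp [sweptForm, add_sub_add_right_eq_sub]

/-- The integer weights `12 / (|A| + 1) ∈ {12, 6, 4, 3}` of `12 · sweptForm`. [folklore] -/
def sweptWeight (A : Finset (Fin 3)) : ℤ := 12 / ((A.card : ℤ) + 1)

/-- `sweptWeight A = 12 · (|A| + 1)⁻¹` in `ℝ`. [folklore] -/
theorem sweptWeight_cast (A : Finset (Fin 3)) :
    (sweptWeight A : ℝ) = 12 * (1 / ((A.card : ℝ) + 1)) := by
  have h : A.card ≤ 3 := by simpa using Finset.card_le_univ A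
  unfold sweptWeight
  generalize A.card = k at h ⊢
  interval_cases k <;> norm_num

/-! #### The prism identity -/

/-- Spec (atoms `Fin.append u z : Fin 10 → V`) of the `j`-th argument of `simplexForm Φ (u + z)`. -/
def specTop (j : Fin 4) : List (Fin 10 × ℤ) :=
  [(Fin.castAdd 5 j.succ, 1), (Fin.castAdd 5 (0 : Fin 5), -1), (Fin.natAdd 5 j.succ, 1),
    (Fin.natAdd 5 (0 : Fin 5), -1)]

/-- Spec of the `j`-th argument of `simplexForm Φ u`. -/
def specBot (j : Fin 4) : List (Fin 10 × ℤ) :=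
  [(Fin.castAdd 5 j.succ, 1), (Fin.castAdd 5 (0 : Fin 5), -1)]

/-- Spec of the arguments of the `A`-th term of `sweptForm Φ (u ∘ i.succAbove) (z ∘ i.succAbove)`. -/
def specSide (i : Fin 5) (A : Finset (Fin 3)) : Fin 4 → List (Fin 10 × ℤ) :=
  Fin.cons (List.ofFn fun k : Fin 4 => (Fin.natAdd 5 (i.succAbove k), (1 : ℤ)))
    (fun j : Fin 3 => if j ∈ A then
        [(Fin.natAdd 5 (i.succAbove j.succ), 1), (Fin.natAdd 5 (i.succAbove 0), -1)]
      else [(Fin.castAdd 5 (i.succAbove j.succ), 1), (Fin.castAdd 5 (i.succAbove 0), -1)])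

/-- Coefficient table of `12 ×` the left-hand side of the prism identity. -/
def prismLHS (c : Fin 4 → Fin 10) : ℤ := 12 * (wordCoef specTop c - wordCoef specBot c)

/-- Coefficient table of `12 ×` the right-hand side of the prism identity. -/
def prismRHS (c : Fin 4 → Fin 10) : ℤ :=
  ∑ i : Fin 5, ∑ A : Finset (Fin 3), (-1 : ℤ) ^ (i : ℕ) * sweptWeight A * wordCoef (specSide i A) c

/-- Kernel-friendly form of `altSum prismRHS w` (determinants, list sums). -/
def prismRHSDet (w : Fin 4 → Fin 10) : ℤ :=
  ((List.finRange 5).map fun i : Fin 5 =>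
    (subsets3.map fun A => (-1 : ℤ) ^ (i : ℕ) * sweptWeight A * tabDet (specSide i A) w).sum).sum

set_option maxRecDepth 100000 in
set_option maxHeartbeats 40000000 in
/-- The kernel's verdict: the two tables have the same alternating sums on sorted words. -/
theorem prism_tables_det : ∀ p q r s : Fin 10, p < q → q < r → r < s →
    12 * (tabDet specTop ![p, q, r, s] - tabDet specBot ![p, q, r, s]) = prismRHSDet ![p, q, r, s] := by
  decide +kernel

/-- The table comparison in `altSum` form. [folklore] -/
theorem prism_tables (p q r s : Fin 10) (hpq : p < q) (hqr : q < r) (hrs : r < s) :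
    altSum prismLHS ![p, q, r, s] = altSum prismRHS ![p, q, r, s] := by
  have h := prism_tables_det p q r s hpq hqr hrs
  have hL : altSum prismLHS ![p, q, r, s] =
      12 * (tabDet specTop ![p, q, r, s] - tabDet specBot ![p, q, r, s]) := by
    rw [← altSum_wordCoef, ← altSum_wordCoef, mul_sub, ← altSum_const_mul, ← altSum_const_mul]
    unfold prismLHS altSum
    rw [← Finset.sum_sub_distrib]
    exact Finset.sum_congr rfl fun π _ => by ring
  have hR : altSum prismRHS ![p, q, r, s] = prismRHSDet ![p, q, r, s] := by
    rw [prismRHSDet, ← sum_fin5]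
    unfold prismRHS
    rw [altSum_finset_sum]
    refine Finset.sum_congr rfl fun i _ => ?_
    rw [← sum_subsets3, altSum_finset_sum]
    refine Finset.sum_congr rfl fun A _ => ?_
    rw [altSum_const_mul, altSum_wordCoef]
  rw [hL, hR, h]

/-- **PRISM IDENTITY**: `h̃_Φ(u + z) - h̃_Φ(u) = Σ_i (-1)^i · sweptForm Φ (u ∘ i.succAbove) (z ∘ i.succAbove)`
— top minus bottom of the prism over a `4`-simplex is the `Φ`-content swept by its five facets (the
chain-homotopy formula `∂P + P∂ = top - bottom` evaluated on a constant `4`-form, written as a polynomial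
identity and checked on coefficient tables). [folklore] -/
theorem simplexForm_add_sub (Φ : V [⋀^Fin 4]→ₗ[ℝ] ℝ) (u z : Fin 5 → V) :
    simplexForm Φ (u + z) - simplexForm Φ u =
      ∑ i : Fin 5, (-1 : ℝ) ^ (i : ℕ) *
        sweptForm Φ (fun j => u (i.succAbove j)) (fun j => z (i.succAbove j)) := by
  set x : Fin 10 → V := Fin.append u z with hx
  have hxl : ∀ k, x (Fin.castAdd 5 k) = u k := fun k => by rw [hx, Fin.append_left]
  have hxr : ∀ k, x (Fin.natAdd 5 k) = z k := fun k => by rw [hx, Fin.append_right]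
  -- the two sides in word form
  have hTop : simplexForm Φ (u + z) = ∑ c : Fin 4 → Fin 10, (wordCoef specTop c : ℝ) * Φ (x ∘ c) := by
    rw [← apply_specArgs, simplexForm]
    congr 1; funext j
    simp only [specTop, vecOfList_cons, vecOfList_nil, hxl, hxr, Pi.add_apply]
    push_cast; simp only [one_smul, neg_smul, add_zero]; abel
  have hBot : simplexForm Φ u = ∑ c : Fin 4 → Fin 10, (wordCoef specBot c : ℝ) * Φ (x ∘ c) := by
    rw [← apply_specArgs, simplexForm]
    congr 1; funext j
    simp only [specBot, vecOfList_cons, vecOfList_nil, hxl]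
    push_cast; simp only [one_smul, neg_smul, add_zero]; abel
  have hSide : ∀ (i : Fin 5) (A : Finset (Fin 3)),
      Φ (Fin.cons (∑ k : Fin 4, z (i.succAbove k))
        (fun j : Fin 3 => if j ∈ A then z (i.succAbove j.succ) - z (i.succAbove 0)
          else u (i.succAbove j.succ) - u (i.succAbove 0))) =
      ∑ c : Fin 4 → Fin 10, (wordCoef (specSide i A) c : ℝ) * Φ (x ∘ c) := by
    intro i A
    rw [← apply_specArgs]
    congr 1; funext j
    refine Fin.cases ?_ (fun j' => ?_) j
    · simp only [specSide, Fin.cons_zero, vecOfList, List.map_ofFn, List.sum_ofFn]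
      refine Finset.sum_congr rfl fun k _ => ?_
      simp only [Function.comp_apply]
      rw [hxr]; simp
    · simp only [specSide, Fin.cons_succ]
      by_cases hj : j' ∈ A
      · rw [if_pos hj, if_pos hj]
        simp only [vecOfList_cons, vecOfList_nil, hxr]
        push_cast; simp only [one_smul, neg_smul, add_zero]; abel
      · rw [if_neg hj, if_neg hj]
        simp only [vecOfList_cons, vecOfList_nil, hxl]
        push_cast; simp only [one_smul, neg_smul, add_zero]; abel
  have hL : 12 * (simplexForm Φ (u + z) - simplexForm Φ u) =
      ∑ c : Fin 4 → Fin 10, (prismLHS c : ℝ) * Φ (x ∘ c) := by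
    rw [hTop, hBot, ← Finset.sum_sub_distrib, Finset.mul_sum]
    refine Finset.sum_congr rfl fun c _ => ?_
    rw [prismLHS]; push_cast; ring
  have hR : 12 * ∑ i : Fin 5, (-1 : ℝ) ^ (i : ℕ) *
        sweptForm Φ (fun j => u (i.succAbove j)) (fun j => z (i.succAbove j)) =
      ∑ c : Fin 4 → Fin 10, (prismRHS c : ℝ) * Φ (x ∘ c) := by
    calc 12 * ∑ i : Fin 5, (-1 : ℝ) ^ (i : ℕ) *
          sweptForm Φ (fun j => u (i.succAbove j)) (fun j => z (i.succAbove j))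
        = ∑ i : Fin 5, ∑ A : Finset (Fin 3), ∑ c : Fin 4 → Fin 10,
            ((-1 : ℝ) ^ (i : ℕ) * (sweptWeight A : ℝ) * (wordCoef (specSide i A) c : ℝ)) *
              Φ (x ∘ c) := by
          rw [Finset.mul_sum]
          refine Finset.sum_congr rfl fun i _ => ?_
          simp only [sweptForm]
          rw [Finset.mul_sum, Finset.mul_sum]
          refine Finset.sum_congr rfl fun A _ => ?_
          rw [hSide i A, Finset.mul_sum, Finset.mul_sum, Finset.mul_sum, sweptWeight_cast]
          refine Finset.sum_congr rfl fun c _ => ?_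
          ring
      _ = ∑ i : Fin 5, ∑ c : Fin 4 → Fin 10, ∑ A : Finset (Fin 3),
            ((-1 : ℝ) ^ (i : ℕ) * (sweptWeight A : ℝ) * (wordCoef (specSide i A) c : ℝ)) *
              Φ (x ∘ c) := Finset.sum_congr rfl fun i _ => Finset.sum_comm
      _ = ∑ c : Fin 4 → Fin 10, ∑ i : Fin 5, ∑ A : Finset (Fin 3),
            ((-1 : ℝ) ^ (i : ℕ) * (sweptWeight A : ℝ) * (wordCoef (specSide i A) c : ℝ)) *
              Φ (x ∘ c) := Finset.sum_comm
      _ = ∑ c : Fin 4 → Fin 10, (prismRHS c : ℝ) * Φ (x ∘ c) := by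
          refine Finset.sum_congr rfl fun c _ => ?_
          rw [prismRHS, Int.cast_sum, Finset.sum_mul]
          refine Finset.sum_congr rfl fun i _ => ?_
          rw [Int.cast_sum, Finset.sum_mul]
          refine Finset.sum_congr rfl fun A _ => ?_
          push_cast; ring
  have h12 : 12 * (simplexForm Φ (u + z) - simplexForm Φ u) =
      12 * ∑ i : Fin 5, (-1 : ℝ) ^ (i : ℕ) *
        sweptForm Φ (fun j => u (i.succAbove j)) (fun j => z (i.succAbove j)) := by
    rw [hL, hR]
    exact sum_eq_of_altSum_eq_on_sorted Φ _ _ x prism_tables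
  exact mul_left_cancel₀ (by norm_num : (12 : ℝ) ≠ 0) h12

/-! #### Alternation of the swept form -/

/-- Spec (atoms `Fin.append y z : Fin 8 → V`) of the arguments of the `A`-th term of
`sweptForm Φ (y ∘ s) (z ∘ s)` for a map `s : Fin 4 → Fin 4`. -/
def specSwept (s : Fin 4 → Fin 4) (A : Finset (Fin 3)) : Fin 4 → List (Fin 8 × ℤ) :=
  Fin.cons (List.ofFn fun k : Fin 4 => (Fin.natAdd 4 (s k), (1 : ℤ)))
    (fun j : Fin 3 => if j ∈ A then [(Fin.natAdd 4 (s j.succ), 1), (Fin.natAdd 4 (s 0), -1)]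
      else [(Fin.castAdd 4 (s j.succ), 1), (Fin.castAdd 4 (s 0), -1)])

/-- Coefficient table of `12 · sweptForm Φ (y ∘ s) (z ∘ s)`. -/
def sweptTable (s : Fin 4 → Fin 4) (c : Fin 4 → Fin 8) : ℤ :=
  ∑ A : Finset (Fin 3), sweptWeight A * wordCoef (specSwept s A) c

/-- Kernel-friendly form of `altSum (sweptTable s) w` (determinants, list sum). -/
def sweptTableDet (s : Fin 4 → Fin 4) (w : Fin 4 → Fin 8) : ℤ :=
  (subsets3.map fun A => sweptWeight A * tabDet (specSwept s A) w).sum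

/-- `altSum (sweptTable s) = sweptTableDet s`. [folklore] -/
theorem altSum_sweptTable (s : Fin 4 → Fin 4) (w : Fin 4 → Fin 8) :
    altSum (sweptTable s) w = sweptTableDet s w := by
  rw [sweptTableDet, ← sum_subsets3]
  unfold sweptTable
  rw [altSum_finset_sum]
  refine Finset.sum_congr rfl fun A _ => ?_
  rw [altSum_const_mul, altSum_wordCoef]

set_option maxRecDepth 100000 in
set_option maxHeartbeats 40000000 in
/-- The kernel's verdict: swapping two indices negates the alternating sums of the table. -/
theorem swept_swap_tables : ∀ a b : Fin 4, a < b → ∀ p q r s : Fin 8, p < q → q < r → r < s →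
    sweptTableDet (Equiv.swap a b) ![p, q, r, s] = - sweptTableDet id ![p, q, r, s] := by
  decide +kernel

/-- `12 ×` the swept form of a reindexed pair `(y ∘ s, z ∘ s)` in word form. [folklore] -/
theorem sweptForm_eq_sum_table (Φ : V [⋀^Fin 4]→ₗ[ℝ] ℝ) (y z : Fin 4 → V) (s : Fin 4 → Fin 4) :
    12 * sweptForm Φ (y ∘ s) (z ∘ s) =
      ∑ c : Fin 4 → Fin 8, (sweptTable s c : ℝ) * Φ (Fin.append y z ∘ c) := by
  set x : Fin 8 → V := Fin.append y z with hx
  have hxl : ∀ k, x (Fin.castAdd 4 k) = y k := fun k => by rw [hx, Fin.append_left]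
  have hxr : ∀ k, x (Fin.natAdd 4 k) = z k := fun k => by rw [hx, Fin.append_right]
  have hA : ∀ A : Finset (Fin 3),
      Φ (Fin.cons (∑ k : Fin 4, (z ∘ s) k)
        (fun j : Fin 3 => if j ∈ A then (z ∘ s) j.succ - (z ∘ s) 0 else (y ∘ s) j.succ - (y ∘ s) 0)) =
      ∑ c : Fin 4 → Fin 8, (wordCoef (specSwept s A) c : ℝ) * Φ (x ∘ c) := by
    intro A
    rw [← apply_specArgs]
    congr 1; funext j
    refine Fin.cases ?_ (fun j' => ?_) j
    · simp only [specSwept, Fin.cons_zero, vecOfList, List.map_ofFn, List.sum_ofFn]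
      refine Finset.sum_congr rfl fun k _ => ?_
      simp only [Function.comp_apply]
      rw [hxr]; simp
    · simp only [specSwept, Fin.cons_succ]
      by_cases hj : j' ∈ A
      · rw [if_pos hj, if_pos hj]
        simp only [vecOfList_cons, vecOfList_nil, hxr, Function.comp_apply]
        push_cast; simp only [one_smul, neg_smul, add_zero]; abel
      · rw [if_neg hj, if_neg hj]
        simp only [vecOfList_cons, vecOfList_nil, hxl, Function.comp_apply]
        push_cast; simp only [one_smul, neg_smul, add_zero]; abel
  calc 12 * sweptForm Φ (y ∘ s) (z ∘ s)
      = ∑ A : Finset (Fin 3), ∑ c : Fin 4 → Fin 8,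
          ((sweptWeight A : ℝ) * (wordCoef (specSwept s A) c : ℝ)) * Φ (x ∘ c) := by
        simp only [sweptForm]
        rw [Finset.mul_sum]
        refine Finset.sum_congr rfl fun A _ => ?_
        rw [hA A, Finset.mul_sum, Finset.mul_sum, sweptWeight_cast]
        refine Finset.sum_congr rfl fun c _ => ?_
        ring
    _ = ∑ c : Fin 4 → Fin 8, (sweptTable s c : ℝ) * Φ (x ∘ c) := by
        rw [Finset.sum_comm]
        refine Finset.sum_congr rfl fun c _ => ?_
        rw [sweptTable, Int.cast_sum, Finset.sum_mul]
        refine Finset.sum_congr rfl fun A _ => ?_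
        push_cast; ring

/-- **The swept form is alternating**: `sweptForm Φ (y ∘ π) (z ∘ π) = sign π · sweptForm Φ y z`
(a transposition reverses the orientation of the swept prism). [folklore] -/
theorem sweptForm_comp_perm (Φ : V [⋀^Fin 4]→ₗ[ℝ] ℝ) (π : Equiv.Perm (Fin 4)) (y z : Fin 4 → V) :
    sweptForm Φ (y ∘ π) (z ∘ π) = (((Equiv.Perm.sign π : ℤˣ) : ℤ) : ℝ) * sweptForm Φ y z := by
  induction π using Equiv.Perm.swap_induction_on' generalizing y z with
  | one => simp
  | mul_swap f a b hab ih =>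
      -- the table check is stated for `a < b`; reduce to that case
      have hswap' : ∀ (a' b' : Fin 4), a' < b' → ∀ y' z' : Fin 4 → V,
          sweptForm Φ (y' ∘ Equiv.swap a' b') (z' ∘ Equiv.swap a' b') = - sweptForm Φ y' z' := by
        intro a' b' hlt y' z'
        have h12 : 12 * sweptForm Φ (y' ∘ Equiv.swap a' b') (z' ∘ Equiv.swap a' b') =
            12 * (- sweptForm Φ y' z') := by
          rw [mul_neg, sweptForm_eq_sum_table,
            show sweptForm Φ y' z' = sweptForm Φ (y' ∘ id) (z' ∘ id) from rfl,
            sweptForm_eq_sum_table, ← Finset.sum_neg_distrib]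
          have hneg : ∑ c : Fin 4 → Fin 8, -((sweptTable id c : ℝ) * Φ (Fin.append y' z' ∘ c)) =
              ∑ c : Fin 4 → Fin 8, ((fun c => - sweptTable id c) c : ℝ) * Φ (Fin.append y' z' ∘ c) :=
            Finset.sum_congr rfl fun c _ => by push_cast; ring
          rw [hneg]
          refine sum_eq_of_altSum_eq_on_sorted Φ _ _ _ fun p q r s hpq hqr hrs => ?_
          have hn : altSum (fun c => - sweptTable id c) ![p, q, r, s] =
              - altSum (sweptTable id) ![p, q, r, s] := by
            have := altSum_const_mul (-1) (sweptTable id) ![p, q, r, s]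
            simpa using this
          rw [hn, altSum_sweptTable, altSum_sweptTable]
          exact swept_swap_tables a' b' hlt p q r s hpq hqr hrs
        exact mul_left_cancel₀ (by norm_num : (12 : ℝ) ≠ 0) h12
      have hswap : ∀ y' z' : Fin 4 → V, sweptForm Φ (y' ∘ Equiv.swap a b) (z' ∘ Equiv.swap a b) =
          - sweptForm Φ y' z' := by
        rcases lt_or_gt_of_ne hab with hlt | hlt
        · exact hswap' a b hlt
        · rw [Equiv.swap_comm]; exact hswap' b a hlt
      rw [Equiv.Perm.coe_mul, ← Function.comp_assoc, ← Function.comp_assoc, hswap, ih,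
        Equiv.Perm.sign_mul, Equiv.Perm.sign_swap hab]
      simp

end Forms

end Summit.HodgeConjecture.HodgeConjecture.Theorems.TropicalHodgeBound
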